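import Summits.KontsevichZagierPeriods.KontsevichZagierPeriods.Theses.TorsionLogs
import Summits.KontsevichZagierPeriods.KontsevichZagierPeriods.Theorems.HurwitzMicroSectorsNormalFormPrincipleDimOneAssembly

/-!
# Route KontsevichZagierPeriods/TorsionLogs — crux `TorsionSectorComplete` (stmt-KontsevichZagierPeriods-14212):
# the crux holds unconditionally in dimensions `≤ 1`

Helper file (`--supports stmt-KontsevichZagierPeriods-14212`, registered sub-goal `dimLeOne`) of
the line lead on the conjecture-grade crux
`Summit.KontsevichZagierPeriods.KontsevichZagierPeriods.Theses.TorsionLogs.TorsionSectorComplete`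
(for `r`, `r'` of KZ's rational shape with equal values, `[r] − [r'] ∈ KZ.relations ⊔ closure T`,
`T` the tied Néron–torsion elements). The crux is Conjecture 1 of Kontsevich–Zagier relative to
the sector and is open; this file records the part of it that is a THEOREM of the tree today:
for representations of dimensions `n, m ≤ 1` it holds outright, because Conjecture 1 itself holds
there — `Summit.KontsevichZagierPeriods.HurwitzMicroSectors.NormalFormPrinciple.PiBox.Dlog.kzConjecture_of_dim_le_one`
(mixed normal forms of one-dimensional rational representations; a vanishing normal form is zero
by Baker's theorem, `Literature.NumberTheory.Transcendental.baker_holds`, proved in the tree) — and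
`KZ.relations ≤ KZ.relations ⊔ closure T`. Values covered: `ℚ̄ ∩ ℝ`, `ℚ̄`-combinations of
logarithms of algebraic numbers and `π` (`log 2 = ∫₁^∞ dx/(x²+x)`, `π = ∫_ℝ dx/(1+x²)`).

The first open layer of the crux is therefore dimension `2` (the surface layer of the line's
skeleton `Lines/birth.lean`: curved planar areas, elliptic periods and quasi-periods, the
dilogarithm layer, and the tied Néron–torsion elements themselves).

Sources: M. Kontsevich, D. Zagier, *Periods* (2001), §1.2 Conjecture 1; A. Baker, *Transcendental
Number Theory* (1975), Thm. 2.1. No definition is introduced; `T` is written out verbatim.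
-/

namespace Summit.KontsevichZagierPeriods.TorsionLogs.TorsionSectorComplete

/-- **The crux `TorsionSectorComplete` in dimensions `≤ 1` (unconditional).** For integral
representations `r : KZ.IntegralRep n`, `r' : KZ.IntegralRep m` of KZ's rational shape with
`n, m ≤ 1` and `r.value = r'.value`, `[r] − [r'] ∈ KZ.relations ⊔ closure T` — indeed already
`[r] − [r'] ∈ KZ.relations` by Conjecture 1 in dimension `≤ 1`
(`PiBox.Dlog.kzConjecture_of_dim_le_one`, Baker's theorem inside).
[Kontsevich–Zagier 2001, §1.2 Conjecture 1; Baker 1975, Thm. 2.1] [folklore] -/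
theorem dimLeOne :
    ∀ ⦃n m : ℕ⦄, n ≤ 1 → m ≤ 1 → ∀ (r : Literature.NumberTheory.Transcendental.KZ.IntegralRep n) (r' : Literature.NumberTheory.Transcendental.KZ.IntegralRep m), r.IsRational → r'.IsRational → r.value = r'.value → Literature.NumberTheory.Transcendental.KZ.of r - Literature.NumberTheory.Transcendental.KZ.of r' ∈ Literature.NumberTheory.Transcendental.KZ.relations ⊔ AddSubgroup.closure {d : Literature.NumberTheory.Transcendental.KZ.FormalRep | ∃ (g₂ g₃ e₁ xP yP α : ℝ) (N a : ℕ) (M k m : ℤ) (f : ℝ → ℝ) (rI rP : Literature.NumberTheory.Transcendental.KZ.IntegralRep 2) (rL : Literature.NumberTheory.Transcendental.KZ.IntegralRep 1), (∀ x, f x = 4 * x ^ 3 - g₂ * x - g₃) ∧ g₂ ^ 3 - 27 * g₃ ^ 2 ≠ 0 ∧ f e₁ = 0 ∧ 0 < e₁ ∧ (∀ x, e₁ < x → 0 < f x) ∧ e₁ < xP ∧ yP ^ 2 = f xP ∧ 3 ≤ N ∧ 0 < a ∧ 2 * a < N ∧ 4 * (N : ℤ) ^ 2 * k = M * ((N :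 ℤ) - 2 * (a : ℤ)) ^ 2 ∧ (∀ hns : (⟨0, 0, 0, -g₂ / 4, -g₃ / 4⟩ : WeierstrassCurve ℝ).toAffine.Nonsingular xP (yP / 2), addOrderOf (WeierstrassCurve.Affine.Point.some xP (yP / 2) hns) = N) ∧ (N : ℝ) * (∫ x in Set.Ioi xP, (Real.sqrt (f x))⁻¹) = a * (2 * ∫ x in Set.Ioi e₁, (Real.sqrt (f x))⁻¹) ∧ 1 < α ∧ rI.domain = {z | e₁ < z 1 ∧ z 1 < z 0 ∧ z 0 < xP} ∧ Set.EqOn rI.integrand (fun z => z 1 / (Real.sqrt (f (z 1)) * Real.sqrt (f (z 0)))) rI.domain ∧ rP.domain = {z | e₁ < z 0 ∧ e₁ < z 1} ∧ Set.EqOn rP.integrand (fun z => (Real.sqrt (f (z 0)))⁻¹ * ((g₂ * z 1 + 2 * g₃) / (2 * (z 1) ^ 2 * Real.sqrt (f (z 1))))) rP.domain ∧ rL.domain = {t | 1 < t 0 ∧ t 0 < α} ∧ Set.EqOn rL.integrand (fun t => (t 0)⁻¹) rL.domain ∧ (M : ℝ) * rI.value + k * rP.value = m * rL.value ∧ d =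 M • Literature.NumberTheory.Transcendental.KZ.of rI + k • Literature.NumberTheory.Transcendental.KZ.of rP - m • Literature.NumberTheory.Transcendental.KZ.of rL} := by
  intro n m hn hm r r' hr hr' hv
  exact AddSubgroup.mem_sup_left
    (Summit.KontsevichZagierPeriods.HurwitzMicroSectors.NormalFormPrinciple.PiBox.Dlog.kzConjecture_of_dim_le_one
      hn hm r r' hr hr' hv)

/-- **Vanishing form in dimension `≤ 1`.** A representation of KZ's rational shape of dimension
`≤ 1` with value `0` lies in `KZ.relations ⊔ closure T` (indeed in `KZ.relations`,
`PiBox.Dlog.of_mem_relations_of_value_eq_zero_of_dim_le_one`).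
[Kontsevich–Zagier 2001, §1.2 Conjecture 1] [folklore] -/
theorem of_mem_enlarged_of_value_eq_zero_of_dim_le_one {m : ℕ} (hm : m ≤ 1)
    (N : Literature.NumberTheory.Transcendental.KZ.IntegralRep m) (hN : N.IsRational) (hv : N.value = 0) :
    Literature.NumberTheory.Transcendental.KZ.of N ∈ Literature.NumberTheory.Transcendental.KZ.relations ⊔ AddSubgroup.closure {d : Literature.NumberTheory.Transcendental.KZ.FormalRep | ∃ (g₂ g₃ e₁ xP yP α : ℝ) (N a : ℕ) (M k m : ℤ) (f : ℝ → ℝ) (rI rP : Literature.NumberTheory.Transcendental.KZ.IntegralRep 2) (rL : Literature.NumberTheory.Transcendental.KZ.IntegralRep 1), (∀ x, f x = 4 * x ^ 3 - g₂ * x - g₃) ∧ g₂ ^ 3 - 27 * g₃ ^ 2 ≠ 0 ∧ f e₁ = 0 ∧ 0 < e₁ ∧ (∀ x, e₁ < x → 0 < f x) ∧ e₁ < xP ∧ yP ^ 2 = f xP ∧ 3 ≤ N ∧ 0 < a ∧ 2 * a < N ∧ 4 * (N : ℤ) ^ 2 * k = M * ((N : ℤ) - 2 * (a : ℤ)) ^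 2 ∧ (∀ hns : (⟨0, 0, 0, -g₂ / 4, -g₃ / 4⟩ : WeierstrassCurve ℝ).toAffine.Nonsingular xP (yP / 2), addOrderOf (WeierstrassCurve.Affine.Point.some xP (yP / 2) hns) = N) ∧ (N : ℝ) * (∫ x in Set.Ioi xP, (Real.sqrt (f x))⁻¹) = a * (2 * ∫ x in Set.Ioi e₁, (Real.sqrt (f x))⁻¹) ∧ 1 < α ∧ rI.domain = {z | e₁ < z 1 ∧ z 1 < z 0 ∧ z 0 < xP} ∧ Set.EqOn rI.integrand (fun z => z 1 / (Real.sqrt (f (z 1)) * Real.sqrt (f (z 0)))) rI.domain ∧ rP.domain = {z | e₁ < z 0 ∧ e₁ < z 1} ∧ Set.EqOn rP.integrand (fun z => (Real.sqrt (f (z 0)))⁻¹ * ((g₂ * z 1 + 2 * g₃) / (2 * (z 1) ^ 2 * Real.sqrt (f (z 1))))) rP.domain ∧ rL.domain = {t | 1 < t 0 ∧ t 0 < α} ∧ Set.EqOn rL.integrand (fun t => (t 0)⁻¹) rL.domain ∧ (M : ℝ) * rI.value + k * rP.value = m * rL.value ∧ d = M • Literature.NumberTheory.Transcendental.KZ.of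 rI + k • Literature.NumberTheory.Transcendental.KZ.of rP - m • Literature.NumberTheory.Transcendental.KZ.of rL} :=
  AddSubgroup.mem_sup_left
    (Summit.KontsevichZagierPeriods.HurwitzMicroSectors.NormalFormPrinciple.PiBox.Dlog.of_mem_relations_of_value_eq_zero_of_dim_le_one
      hm N hN hv)

end Summit.KontsevichZagierPeriods.TorsionLogs.TorsionSectorComplete
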